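import Literature.NumberTheory.DiophantineGeometry.FunctionFieldGenusProofs

/-!
# Algebraic function fields of one variable — the degree of a place is positive

Discharge of the named fact `Literature.NumberTheory.DiophantineGeometry.AlgFunctionField.PlaceOver.degree_pos` stated in
`Literature.NumberTheory.DiophantineGeometry.FunctionFieldGenus`
(kept in a sibling file: the statement file stays a definitions/named-facts file, and the
finiteness theorem it rests on lives in `FunctionFieldGenusProofs`).

* `AlgFunctionField.PlaceOver.degree_pos_holds : PlaceOver.degree_pos`, i.e. `0 < deg v` for
  every place `v` of an algebraic function field of one variable `F/K`.

## Source and proof (Stichtenoth, *Algebraic Function Fields and Codes*, GTM 254, 2009, §1.1)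

* Def. 1.1.14 (b) (p. 6): `deg P := [F_P : K]`, where `F_P = O_P / P` is the residue class field;
  just before Def. 1.1.14 (p. 6): by Prop. 1.1.5, `K ⊆ O_P` and `K ∩ P = {0}`, so the residue class
  map induces a canonical embedding `K ↪ F_P`.
* Prop. 1.1.15 (pp. 6–7): if `0 ≠ x ∈ P` then `deg P ≤ [F : K(x)] < ∞` — "the degree of a place
  is always finite". In this library that is the named fact
  `PlaceOver.finiteDimensional_residueField`, discharged by
  `PlaceOver.finiteDimensional_residueField_holds` (`FunctionFieldGenusProofs`).

Hence `F_P` is a nonzero (`F_P` is a field) finite-dimensional `K`-vector space, so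
`deg P = dim_K F_P ≥ 1`. In Lean `PlaceOver.degree v = Module.finrank K v.residueField`, whose
junk value `0` for an infinite-dimensional residue field is excluded exactly by Prop. 1.1.15;
positivity is then `Module.finrank_pos`. The fact is stated correctly (not weakened, not
misstated).

## References

* H. Stichtenoth, *Algebraic Function Fields and Codes*, 2nd ed., GTM 254, Springer 2009,
  §1.1: Prop. 1.1.5, Def. 1.1.14, Prop. 1.1.15 (pp. 4–7). doi:10.1007/978-3-540-76878-4.
-/

noncomputable section

namespace Literature.NumberTheory.DiophantineGeometry

namespace AlgFunctionField.PlaceOver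

universe u v

variable {K : Type u} {F : Type v} [Field K] [Field F] [Algebra K F]

/-- **Discharge of `PlaceOver.degree_pos`** (Stichtenoth Def. 1.1.14 (b) with Prop. 1.1.15): the
degree `deg v = [F_v : K]` of a place `v` of an algebraic function field of one variable `F/K` is
positive. Proof: `F_v = O_v / m_v` is a field, hence a nontrivial `K`-vector space (`K ↪ F_v` via
the residue class map, Prop. 1.1.5), and it is finite-dimensional over `K` by Prop. 1.1.15
(`PlaceOver.finiteDimensional_residueField_holds`), so `0 < dim_K F_v` (`Module.finrank_pos`).
[cite: Stichtenoth2009, Def. 1.1.14(b) and Prop. 1.1.15 (§1.1, pp. 6–7)] -/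
theorem degree_pos_holds : (PlaceOver.degree_pos (K := K) (F := F)) := by
  intro _ v
  haveI : FiniteDimensional K v.residueField :=
    finiteDimensional_residueField_holds (K := K) (F := F) v
  exact Module.finrank_pos

/-- Pointwise form of `degree_pos_holds`: `0 < deg v` for a place `v` of an algebraic function
field of one variable. [cite: Stichtenoth2009, Def. 1.1.14(b) and Prop. 1.1.15] -/
theorem degree_pos_of_isAlgFunctionField [IsAlgFunctionField K F] (v : PlaceOver K F) :
    0 < v.degree :=
  degree_pos_holds v

/-- Equivalently `1 ≤ deg v`, the form used when bounding degrees of divisors from below.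
[cite: Stichtenoth2009, Def. 1.1.14(b) and Prop. 1.1.15] -/
theorem one_le_degree [IsAlgFunctionField K F] (v : PlaceOver K F) : 1 ≤ v.degree :=
  degree_pos_holds v

end AlgFunctionField.PlaceOver

end Literature.NumberTheory.DiophantineGeometry
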